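import Summits.QuantumAdvantage.QuantumAdvantage.Theorems.ArithStatLadderAvgFaceBeyondPriorMirrorUnitData
import Literature.Computability.Cryptography.HallgrenClassGroup
import Literature.Computability.Cryptography.HallgrenClassGroupDiscriminant
import Literature.Computability.Cryptography.HallgrenClassGroupSamplerCount
import Literature.Computability.Cryptography.HallgrenPell
import Literature.Computability.Cryptography.HallgrenPellHolds
import Literature.Computability.Cryptography.HallgrenPellProofs
import Literature.Computability.Cryptography.ClassBQPReductionProofs
import Literature.Computability.Cryptography.ShorAssemblyLeavesProofs
import Literature.Computability.Cryptography.ShorFactPostMemFP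
import Literature.Computability.QuantumComplexity.PromiseWrap
import Literature.Computability.Complexity.BranchingFn
import Literature.Computability.Complexity.StackBricksArith
import Literature.Computability.Complexity.ZIntBricks
import Literature.NumberTheory.QuadraticFields.ThreeTorsion
import Literature.NumberTheory.QuadraticFields.ScholzReflection
import Literature.NumberTheory.QuadraticFields.ScholzHeckeUnitCriterion
import Literature.NumberTheory.QuadraticFields.RealQuadraticRegulator
import Literature.NumberTheory.QuadraticFields.QuadraticDedekindZetaKronecker
import Literature.NumberTheory.LFunctions.LandauPageRealZeros
import Literature.NumberTheory.LFunctions.SiegelTheorem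

/-!
# Crux `ArithStatLadder.IqThreeMemBQP` (stmt-QuantumAdvantage-2424), line `scholz-mirror-siegel` — stub `stub_frontEnd`

Registered stub of the line skeleton `Cruxes/IqThreeMemBQP/Lines/scholz_mirror_siegel.lean` (reshape r3:
the signature below is stated over tree constants only and must stay BYTE-IDENTICAL to the registered
one — edit only the proof and add helper lemmas above it).

Proof summary (plumbing over PROVED tree facts; no definition — every classical map is an `FP` brick composite
built inside a proof and exported as `∃ f ∈ FP, …`). (i) `FUND ∈ BQP` (`fund_mem_BQP`): `−d` fundamental iff
`d ≡ 3 (4)` or `d ≡ 4, 8 (16)` and the core `d` resp. `d/4` has a repetition-free prime-factor list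
(`isNegFundamentalDiscr_iff`); Shor's `isQSolvable_factoring_holds` on the core (`exists_fundPre`) inside ONE
`isQSolvable_classicalWrap_holds` whose post-processor (`exists_fundPost`) writes the membership bit on EVERY input
(`fund_conditions_iff`); then `mem_BQP_of_isQSolvable_bit`. (ii) the unit-cube promise problem (`cube_mem_PromiseBQP`):
ONE `mem_PromiseBQP_of_isQSolvable` around `Hallgren2007_regulator_qsolvable_delim_holds`, pre-processor
`bin d ↦ bin (mirrorRadicand d)` (`exists_mirrorPre`); on the promise `stub_mirrorUnitData` (sister Theorems file) gives
`d₀` square-free `≥ 2`, THE pair `IsMirrorFundUnit d a b` and `|log ε − m| < 1` for Hallgren's `m` (field with `√d₀`: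
`exists_quadraticField_sqrt`), so the `FP` map of `JacobsonWilliams2008_unitResidue_mem_FP_holds` returns
`(a mod 9, b mod 9)`; the post-processor (`exists_cubePost`) squares `a + b√d₀` three times modulo `9`
(`sq_step_zmod`, in `ZMod 9`) and evaluates the two divisibility tests of `UnitCubeAtThree`.
-/

namespace Summit.QuantumAdvantage.QuantumAdvantage.Theorems.ArithStatLadder.IqThreeMemBQP

open scoped NumberField nonZeroDivisors
open _root_.Computability Literature.Computability.Complexity Literature.Computability.Cryptography
open Literature.NumberTheory.QuadraticFields

/-! ## Helper lemmas -/

section Helpers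

open Literature.Computability.Complexity.Brick Literature.Computability.Complexity.CanonCode

/-- `canonListFn canonF` re-encodes a self-delimited list code followed by garbage. [folklore] -/
private theorem canonListFn_encode_append (L : List ℕ) (w : List Bool) :
    canonListFn canonF (encodingListNatBool.encode L ++ w) = encodingListNatBool.encode L := by
  have h := FactPostFP.encodingListNatBool_decode (encodingListNatBool.encode L ++ w)
  rw [listBool_decode_encode_append] at h
  rw [h.2, ← Option.some.inj h.1]

/-- `nodupFn` on the code of a list of naturals decides `List.Nodup`. [folklore] -/
private theorem nodupFn_encode (L : List ℕ) : nodupFn (encodingListNatBool.encode L) = [decide L.Nodup] := by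
  have h := nodupFn_encList_eq_true (unaryEncodeNat L.length) (L.map encodingNatBool.encode)
  rw [List.nodup_map_iff encodingNatBool.encode_injective, ← listBool_encode_eq_encList] at h
  obtain ⟨b, hb⟩ := oneBit_nodupFn (encodingListNatBool.encode L)
  rw [hb] at h ⊢
  by_cases hL : L.Nodup
  · rw [decide_eq_true hL, h.2 hL]
  · cases b <;> [rw [decide_eq_false hL]; exact absurd (h.1 rfl) hL]

/-- Arithmetic form of "`−d` is a negative fundamental discriminant": `d ≡ 3 (mod 4)` with `d`
square-free, or `d ≡ 4, 8 (mod 16)` with `d/4` square-free. [folklore] -/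
private theorem isNegFundamentalDiscr_iff (d : ℕ) : IsNegFundamentalDiscr d ↔
    (d % 4 = 3 ∨ d % 16 = 4 ∨ d % 16 = 8) ∧ Squarefree (if 4 ∣ d then d / 4 else d) := by
  have hneg : ∀ n : ℕ, Squarefree (-(n : ℤ)) ↔ Squarefree n := fun n => by
    rw [← Int.squarefree_natAbs, Int.natAbs_neg, Int.natAbs_natCast]
  have hq : (-(d : ℤ)) / 4 = -((d / 4 : ℕ) : ℤ) ∨ ¬ 4 ∣ d := by omega
  unfold IsNegFundamentalDiscr
  constructor
  · rintro (⟨h1, h2, -⟩ | ⟨h4, h2, h3⟩)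
    · rw [if_neg (by omega)]; exact ⟨Or.inl (by omega), (hneg d).1 h2⟩
    · rw [if_pos (by omega), ← hneg, ← hq.resolve_right (by omega)]; exact ⟨Or.inr (by omega), h3⟩
  · rintro ⟨h | h, hsq⟩
    · rw [if_neg (by omega)] at hsq; exact Or.inl ⟨by omega, (hneg d).2 hsq, by omega⟩
    · rw [if_pos (by omega), ← hneg, ← hq.resolve_right (by omega)] at hsq
      exact Or.inr ⟨by omega, by omega, hsq⟩

/-- The bit written by the wrapped family is membership in `FUND`: `x` is the binary code of a `d` with
`−d` fundamental iff `x` is canonical, `⟦x⟧` passes the congruences and the prime-factor list of the core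
of `⟦x⟧` has no repetition. [folklore] -/
private theorem fund_conditions_iff (x : List Bool) :
    (canonF x = x ∧ (decodeNat x % 4 = 3 ∨ decodeNat x % 16 = 4 ∨ decodeNat x % 16 = 8) ∧
        ((if 4 ∣ decodeNat x then decodeNat x / 4 else decodeNat x).primeFactorsList).Nodup) ↔
      x ∈ encodingNatBool.toLanguage {d : ℕ | IsNegFundamentalDiscr d} := by
  have hcore : ∀ n : ℕ, (n % 4 = 3 ∨ n % 16 = 4 ∨ n % 16 = 8) → (if 4 ∣ n then n / 4 else n) ≠ 0 :=
    fun n hn => by split_ifs <;> omega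
  change _ ↔ x ∈ encodingNatBool.encode '' {d : ℕ | IsNegFundamentalDiscr d}
  rw [Set.mem_image]
  constructor
  · rintro ⟨hx, harith, hnd⟩
    refine ⟨decodeNat x, ?_, (canonF_eq_encodeNat_decodeNat x).symm.trans hx⟩
    rw [Set.mem_setOf_eq, isNegFundamentalDiscr_iff]
    exact ⟨harith, (Nat.squarefree_iff_nodup_primeFactorsList (hcore _ harith)).2 hnd⟩
  · rintro ⟨d, hd, rfl⟩
    rw [Set.mem_setOf_eq, isNegFundamentalDiscr_iff] at hd
    have hdec : decodeNat (encodingNatBool.encode d) = d := decode_encodeNat d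
    rw [hdec, canonF_eq_encodeNat_decodeNat, hdec]
    exact ⟨rfl, hd.1, (Nat.squarefree_iff_nodup_primeFactorsList (hcore _ hd.1)).1 hd.2⟩

/-- The pre-processor of `FUND` (`FP`): `x ↦ bin (core ⟦x⟧)`, `core n = n/4` if `4 ∣ n`, else `n`. [folklore] -/
private theorem exists_fundPre : ∃ pre : List Bool → List Bool, pre ∈ FP ∧
    ∀ x, pre x = encodeNat (if 4 ∣ decodeNat x then decodeNat x / 4 else decodeNat x) := by
  refine ⟨iteFn (isNilFn ∘ remFn ∘ fanoutFn canonF (fun _ => encodeNat 4))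
      (divFn ∘ fanoutFn canonF (fun _ => encodeNat 4)) canonF,
    iteFn_mem_FP (comp_mem_FP isNilFn_mem_FP (comp_mem_FP remFn_mem_FP (fanoutFn_mem_FP canonF_mem_FP (const_mem_FP _))))
      (comp_mem_FP divFn_mem_FP (fanoutFn_mem_FP canonF_mem_FP (const_mem_FP _))) canonF_mem_FP, fun x => ?_⟩
  have hc : (isNilFn ∘ remFn ∘ fanoutFn canonF (fun _ => encodeNat 4)) x = [decide (decodeNat x % 4 = 0)] := by
    simp [isNilFn, bitsToNat_canonF, encodeNat_eq_nil_iff]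
  rw [iteFn_apply hc]
  by_cases h4 : 4 ∣ decodeNat x
  · rw [if_pos (decide_eq_true (Nat.mod_eq_zero_of_dvd h4)), if_pos h4]
    simp [bitsToNat_canonF]
  · rw [if_neg (by rw [decide_eq_true_eq]; exact fun h => h4 (Nat.dvd_of_mod_eq_zero h)), if_neg h4]
    exact canonF_eq_encodeNat_decodeNat x

/-- The post-processor of `FUND` (`FP`): on `⟨x, code L ++ w⟩` it writes the bit "`x` canonical ∧
congruences of `⟦x⟧` ∧ `L` repetition-free" (`eqPairFn`, `remFn/eqValFn`, `nodupFn ∘ canonListFn canonF`).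
[folklore] -/
private theorem exists_fundPost : ∃ post : List Bool → List Bool, post ∈ FP ∧
    ∀ (x : List Bool) (L : List ℕ) (w : List Bool), post (boolPair x (encodingListNatBool.encode L ++ w)) =
      [decide (canonF x = x ∧ (decodeNat x % 4 = 3 ∨ decodeNat x % 16 = 4 ∨ decodeNat x % 16 = 8) ∧
        L.Nodup)] := by
  -- the congruence test `⟦x⟧ mod k = r`
  set T : ℕ → ℕ → List Bool → List Bool := fun k r =>
    eqValFn ∘ fanoutFn (remFn ∘ fanoutFn (canonF ∘ fstF) (fun _ => encodeNat k)) (fun _ => encodeNat r) with hT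
  have hTFP : ∀ k r, T k r ∈ FP := fun k r => by
    rw [hT]; exact comp_mem_FP eqValFn_mem_FP (fanoutFn_mem_FP (comp_mem_FP remFn_mem_FP
      (fanoutFn_mem_FP (comp_mem_FP canonF_mem_FP fstF_mem_FP) (const_mem_FP _))) (const_mem_FP _))
  have hT_apply : ∀ (k r : ℕ) (x y : List Bool), T k r (boolPair x y) = [decide (decodeNat x % k = r)] :=
    fun k r x y => by rw [hT]; simp [bitsToNat_canonF]
  refine ⟨andFn (eqPairFn ∘ fanoutFn (canonF ∘ fstF) fstF)
      (andFn (orFn (T 4 3) (orFn (T 16 4) (T 16 8))) (nodupFn ∘ canonListFn canonF ∘ sndF)),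
    andFn_mem_FP (comp_mem_FP eqPairFn_mem_FP (fanoutFn_mem_FP (comp_mem_FP canonF_mem_FP fstF_mem_FP) fstF_mem_FP))
      (andFn_mem_FP (orFn_mem_FP (hTFP 4 3) (orFn_mem_FP (hTFP 16 4) (hTFP 16 8)))
        (comp_mem_FP nodupFn_mem_FP (comp_mem_FP (canonListFn_mem_FP canonF_mem_FP length_canonF_le) sndF_mem_FP))),
    fun x L w => ?_⟩
  have h1 : (eqPairFn ∘ fanoutFn (canonF ∘ fstF) fstF) (boolPair x (encodingListNatBool.encode L ++ w)) =
      [decide (canonF x = x)] := by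
    simp [eqPairFn_boolPair]
  have h3 : (nodupFn ∘ canonListFn canonF ∘ sndF) (boolPair x (encodingListNatBool.encode L ++ w)) = [decide L.Nodup] := by
    rw [Function.comp_apply, Function.comp_apply, sndF_boolPair, canonListFn_encode_append, nodupFn_encode]
  rw [andFn_apply h1 (andFn_apply (orFn_apply (hT_apply 4 3 _ _) (orFn_apply (hT_apply 16 4 _ _) (hT_apply 16 8 _ _))) h3)]
  congr 1
  rw [Bool.eq_iff_iff]
  simp only [Bool.and_eq_true, Bool.or_eq_true, decide_eq_true_eq]

/-- **(i) `FUND ∈ BQP`**: Shor's factoring relation on the core, inside one classical wrap, writes the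
membership bit on every input; read wire `0`. [folklore] -/
theorem fund_mem_BQP : encodingNatBool.toLanguage {d : ℕ | IsNegFundamentalDiscr d} ∈ BQP := by
  classical
  obtain ⟨pre, hpre, hpre_apply⟩ := exists_fundPre
  obtain ⟨post, hpost, hpost_apply⟩ := exists_fundPost
  have hwrap := isQSolvable_classicalWrap_holds pre post hpre hpost isQSolvable_factoring_holds
  have hbit : IsQSolvable fun x =>
      {z | [decide (x ∈ encodingNatBool.toLanguage {d : ℕ | IsNegFundamentalDiscr d})] <+: z} := by
    refine hwrap.mono fun x z hz => ?_
    simp only [Set.mem_setOf_eq] at hz ⊢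
    obtain ⟨y, ⟨w, rfl⟩, hz⟩ := hz
    rw [hpre_apply, decode_encodeNat, hpost_apply, decide_eq_decide.2 (fund_conditions_iff x)] at hz
    exact hz
  exact mem_BQP_of_isQSolvable_bit (fun _ _ => QCircuit.outputPMF_apply_holds) cliffordT_isUnitary_holds
    (fun x => decide_eq_true_iff) hbit

/-- A quadratic number field containing `√n` (`n ≥ 2` square-free): the field of discriminant
`fundDiscr n ∈ {n, 4n}` contains `√(disc)`, hence `√n`. [folklore] -/
private theorem exists_quadraticField_sqrt {n : ℕ} (hsf : Squarefree n) (h2 : 2 ≤ n) :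
    ∃ (K : Type) (_ : Field K) (_ : NumberField K), Module.finrank ℚ K = 2 ∧ ∃ α : K, α ^ 2 = (n : K) := by
  obtain ⟨K, _, _, hK, hdisc⟩ := Quadratic.exists_numberField_discr_eq (Quadratic.isFundamental_fundDiscr hsf h2)
  obtain ⟨δ, -, hδ⟩ := Quadratic.exists_not_mem_range_sq_eq_discr (K := K) hK
  rw [hdisc] at hδ
  refine ⟨K, inferInstance, inferInstance, hK, ?_⟩
  by_cases h4 : n % 4 = 1
  · exact ⟨δ, by rw [hδ, Quadratic.fundDiscr_of_mod_four_eq_one h4]; simp⟩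
  · refine ⟨δ / 2, ?_⟩
    rw [div_pow, hδ, Quadratic.fundDiscr_of_mod_four_ne_one h4]
    simp only [Int.cast_mul, Int.cast_ofNat, Int.cast_natCast, map_mul, map_natCast, map_ofNat]
    ring

/-- One squaring step modulo `9` in `ℤ[√e]`: if `(u, v, E)` reduce to `(re z, im z, e)` modulo `9` then
`((u² + E v²) mod 9, (2uv) mod 9)` reduce to `(re z², im z²)`. [folklore] -/
private theorem sq_step_zmod {e : ℤ} (z : ℤ√e) {u v E : ℕ} (hu : (u : ZMod 9) = z.re) (hv : (v : ZMod 9) = z.im)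
    (hE : (E : ZMod 9) = e) :
    (((u * u + E * (v * v)) % 9 : ℕ) : ZMod 9) = (z * z).re ∧
      (((2 * (u * v)) % 9 : ℕ) : ZMod 9) = (z * z).im := by
  rw [ZMod.natCast_mod, Zsqrtd.re_mul, ZMod.natCast_mod, Zsqrtd.im_mul]
  push_cast
  rw [hu, hv, hE]
  constructor <;> ring

/-- The pre-processor `bin d ↦ bin (mirrorRadicand d)` is in `FP`: `mirrorRadicand d` is `c/3` if `3 ∣ c`
and `3c` otherwise, `c` the core of `d` (`exists_fundPre`); one more `iteFn`. [folklore] -/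
private theorem exists_mirrorPre :
    ∃ pre : List Bool → List Bool, pre ∈ FP ∧ ∀ n : ℕ, pre (encodeNat n) = encodeNat (mirrorRadicand n) := by
  obtain ⟨p, hp, hp_apply⟩ := exists_fundPre
  have hid : (fun w : List Bool => w) ∈ FP := PolyTimeComputable.id _
  refine ⟨iteFn (isNilFn ∘ remFn ∘ fanoutFn (fun w => w) (fun _ => encodeNat 3))
      (divFn ∘ fanoutFn (fun w => w) (fun _ => encodeNat 3)) (prodFn ∘ fanoutFn (fun _ => encodeNat 3) (fun w => w)) ∘ p,
    comp_mem_FP (iteFn_mem_FP (comp_mem_FP isNilFn_mem_FP (comp_mem_FP remFn_mem_FP (fanoutFn_mem_FP hid (const_mem_FP _))))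
      (comp_mem_FP divFn_mem_FP (fanoutFn_mem_FP hid (const_mem_FP _)))
      (comp_mem_FP prodFn_mem_FP (fanoutFn_mem_FP (const_mem_FP _) hid))) hp, fun n => ?_⟩
  rw [Function.comp_apply, hp_apply, decode_encodeNat]
  generalize hc : (if 4 ∣ n then n / 4 else n) = c
  have hmr : mirrorRadicand n = if c % 3 = 0 then c / 3 else 3 * c := by
    unfold mirrorRadicand; split_ifs at hc ⊢ <;> omega
  have hc3 : (isNilFn ∘ remFn ∘ fanoutFn (fun w => w) (fun _ => encodeNat 3)) (encodeNat c) = [decide (c % 3 = 0)] := by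
    simp [isNilFn, encodeNat_eq_nil_iff]
  rw [hmr, iteFn_apply hc3]
  by_cases h3 : c % 3 = 0
  · rw [if_pos (decide_eq_true h3), if_pos h3]; simp
  · rw [if_neg (by rw [decide_eq_true_eq]; exact h3), if_neg h3]; simp

/-- The post-processor of the unit-cube test (`FP`, for given `f, pre ∈ FP`): on `⟨x, ⟨bin m, w⟩⟩` it
forms `⟨pre x, ⟨bin m, bin 9⟩⟩`, applies `f` (expected to return `⟨bin A, bin B⟩`), squares `A + B√E`
three times modulo `9` (`E = ⟦pre x⟧ mod 9`) and outputs the bit `[P₁ = 4] ∧ (3 ∣ ⟦x⟧ ? [P₂ = 0] : [3 ∣ P₂])`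
of the result `(P₁, P₂)` — which reduces to `z⁸` for every `z ∈ ℤ[√e]` reducing to `(A, B, E)`.
[folklore] -/
private theorem exists_cubePost {f pre : List Bool → List Bool} (hf : f ∈ FP) (hpre : pre ∈ FP) :
    ∃ post : List Bool → List Bool, post ∈ FP ∧
      ∀ (x : List Bool) (m : ℕ) (w : List Bool) (A B : ℕ),
        f (boolPair (pre x) (boolPair (encodeNat m) (encodeNat 9))) = boolPair (encodeNat A) (encodeNat B) →
        ∃ P₁ P₂ : ℕ, P₁ < 9 ∧ P₂ < 9 ∧
          (∀ (e : ℤ) (z : ℤ√e), (A : ZMod 9) = z.re → (B : ZMod 9) = z.im →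
              ((bitsToNat (pre x) : ℕ) : ZMod 9) = e →
            (P₁ : ZMod 9) = (z ^ 8).re ∧ (P₂ : ZMod 9) = (z ^ 8).im) ∧
          post (boolPair x (boolPair (encodeNat m) w)) =
            [decide (P₁ = 4) &&
              (if bitsToNat x % 3 = 0 then decide (P₂ = 0) else decide (P₂ % 3 = 0))] := by
  have hU : fstF ∘ sndF ∈ FP := comp_mem_FP fstF_mem_FP sndF_mem_FP
  have hV : sndF ∘ sndF ∈ FP := comp_mem_FP sndF_mem_FP sndF_mem_FP
  -- one squaring step modulo `9` on a state word `⟨bin E, ⟨bin u, bin v⟩⟩`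
  set sq : List Bool → List Bool :=
    fanoutFn fstF (fanoutFn
      (remFn ∘ fanoutFn (addFn ∘ fanoutFn (prodFn ∘ fanoutFn (fstF ∘ sndF) (fstF ∘ sndF))
        (prodFn ∘ fanoutFn fstF (prodFn ∘ fanoutFn (sndF ∘ sndF) (sndF ∘ sndF)))) (fun _ => encodeNat 9))
      (remFn ∘ fanoutFn (prodFn ∘ fanoutFn (fun _ => encodeNat 2)
        (prodFn ∘ fanoutFn (fstF ∘ sndF) (sndF ∘ sndF))) (fun _ => encodeNat 9))) with hsq
  -- initial state `⟨bin (⟦pre x⟧ mod 9), f ⟨pre x, ⟨bin m, bin 9⟩⟩⟩`, then three squarings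
  set S : List Bool → List Bool := sq ∘ sq ∘ sq ∘
    fanoutFn (remFn ∘ fanoutFn (pre ∘ fstF) (fun _ => encodeNat 9))
      (f ∘ fanoutFn (pre ∘ fstF) (fanoutFn (fstF ∘ sndF) (fun _ => encodeNat 9))) with hS
  set T : List Bool → List Bool := isNilFn ∘ remFn ∘ fanoutFn fstF (fun _ => encodeNat 3) with hT
  have hsqFP : sq ∈ FP := by
    rw [hsq]
    exact fanoutFn_mem_FP fstF_mem_FP (fanoutFn_mem_FP
      (comp_mem_FP remFn_mem_FP (fanoutFn_mem_FP (comp_mem_FP addFn_mem_FP (fanoutFn_mem_FP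
        (comp_mem_FP prodFn_mem_FP (fanoutFn_mem_FP hU hU)) (comp_mem_FP prodFn_mem_FP
          (fanoutFn_mem_FP fstF_mem_FP (comp_mem_FP prodFn_mem_FP (fanoutFn_mem_FP hV hV))))))
        (const_mem_FP _)))
      (comp_mem_FP remFn_mem_FP (fanoutFn_mem_FP (comp_mem_FP prodFn_mem_FP
        (fanoutFn_mem_FP (const_mem_FP _) (comp_mem_FP prodFn_mem_FP (fanoutFn_mem_FP hU hV))))
        (const_mem_FP _))))
  have hSFP : S ∈ FP := by
    rw [hS]
    exact comp_mem_FP hsqFP (comp_mem_FP hsqFP (comp_mem_FP hsqFP (fanoutFn_mem_FP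
      (comp_mem_FP remFn_mem_FP (fanoutFn_mem_FP (comp_mem_FP hpre fstF_mem_FP) (const_mem_FP _)))
      (comp_mem_FP hf (fanoutFn_mem_FP (comp_mem_FP hpre fstF_mem_FP)
        (fanoutFn_mem_FP hU (const_mem_FP _)))))))
  have hTFP : T ∈ FP := by
    rw [hT]; exact comp_mem_FP isNilFn_mem_FP (comp_mem_FP remFn_mem_FP (fanoutFn_mem_FP fstF_mem_FP (const_mem_FP _)))
  have hsq_apply : ∀ E u v : ℕ, sq (boolPair (encodeNat E) (boolPair (encodeNat u) (encodeNat v))) =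
      boolPair (encodeNat E) (boolPair (encodeNat ((u * u + E * (v * v)) % 9)) (encodeNat ((2 * (u * v)) % 9))) := by
    intro E u v; rw [hsq]; simp
  have hT_apply : ∀ x y : List Bool, T (boolPair x y) = [decide (bitsToNat x % 3 = 0)] := fun x y => by
    rw [hT]; simp [isNilFn, encodeNat_eq_nil_iff]
  refine ⟨andFn (eqValFn ∘ fanoutFn (fstF ∘ sndF ∘ S) (fun _ => encodeNat 4))
      (iteFn T (isNilFn ∘ sndF ∘ sndF ∘ S) (isNilFn ∘ remFn ∘ fanoutFn (sndF ∘ sndF ∘ S) (fun _ => encodeNat 3))),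
    andFn_mem_FP (comp_mem_FP eqValFn_mem_FP
        (fanoutFn_mem_FP (comp_mem_FP fstF_mem_FP (comp_mem_FP sndF_mem_FP hSFP)) (const_mem_FP _)))
      (iteFn_mem_FP hTFP (comp_mem_FP isNilFn_mem_FP (comp_mem_FP sndF_mem_FP (comp_mem_FP sndF_mem_FP hSFP)))
        (comp_mem_FP isNilFn_mem_FP (comp_mem_FP remFn_mem_FP
          (fanoutFn_mem_FP (comp_mem_FP sndF_mem_FP (comp_mem_FP sndF_mem_FP hSFP)) (const_mem_FP _))))),
    fun x m w A B hfx => ?_⟩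
  set E : ℕ := bitsToNat (pre x) % 9 with hE
  set u₁ : ℕ := (A * A + E * (B * B)) % 9
  set v₁ : ℕ := (2 * (A * B)) % 9
  set u₂ : ℕ := (u₁ * u₁ + E * (v₁ * v₁)) % 9
  set v₂ : ℕ := (2 * (u₁ * v₁)) % 9
  set u₃ : ℕ := (u₂ * u₂ + E * (v₂ * v₂)) % 9
  set v₃ : ℕ := (2 * (u₂ * v₂)) % 9
  have hS0 : fanoutFn (remFn ∘ fanoutFn (pre ∘ fstF) (fun _ => encodeNat 9))
      (f ∘ fanoutFn (pre ∘ fstF) (fanoutFn (fstF ∘ sndF) (fun _ => encodeNat 9)))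
        (boolPair x (boolPair (encodeNat m) w)) = boolPair (encodeNat E) (boolPair (encodeNat A) (encodeNat B)) := by
    simp [hfx, hE]
  have hS_apply : S (boolPair x (boolPair (encodeNat m) w)) =
      boolPair (encodeNat E) (boolPair (encodeNat u₃) (encodeNat v₃)) := by
    rw [hS]; simp only [Function.comp_apply]; rw [hS0, hsq_apply, hsq_apply, hsq_apply]
  have hre : (eqValFn ∘ fanoutFn (fstF ∘ sndF ∘ S) (fun _ => encodeNat 4)) (boolPair x (boolPair (encodeNat m) w)) =
      [decide (u₃ = 4)] := by
    simp only [Function.comp_apply, fanoutFn_apply, hS_apply, fstF_boolPair, sndF_boolPair, eqValFn_boolPair,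
      bitsToNat_encodeNat]
  have him9 : (isNilFn ∘ sndF ∘ sndF ∘ S) (boolPair x (boolPair (encodeNat m) w)) = [decide (v₃ = 0)] := by
    simp only [Function.comp_apply, hS_apply, sndF_boolPair, isNilFn, encodeNat_eq_nil_iff]
  have him3 : (isNilFn ∘ remFn ∘ fanoutFn (sndF ∘ sndF ∘ S) (fun _ => encodeNat 3))
      (boolPair x (boolPair (encodeNat m) w)) = [decide (v₃ % 3 = 0)] := by
    simp only [Function.comp_apply, fanoutFn_apply, hS_apply, sndF_boolPair, remFn_boolPair, bitsToNat_encodeNat,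
      isNilFn, encodeNat_eq_nil_iff]
  refine ⟨u₃, v₃, Nat.mod_lt _ (by norm_num), Nat.mod_lt _ (by norm_num), fun e z hA hB he => ?_, ?_⟩
  · have hE' : (E : ZMod 9) = e := by rw [hE, ZMod.natCast_mod]; exact he
    obtain ⟨h1, h1'⟩ := sq_step_zmod z hA hB hE'
    obtain ⟨h2, h2'⟩ := sq_step_zmod (z * z) h1 h1' hE'
    obtain ⟨h3, h3'⟩ := sq_step_zmod (z * z * (z * z)) h2 h2' hE'
    rw [show z ^ 8 = z * z * (z * z) * (z * z * (z * z)) by ring]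
    exact ⟨h3, h3'⟩
  · by_cases ht : bitsToNat x % 3 = 0
    · rw [if_pos ht]
      exact andFn_apply hre (by rw [iteFn_apply_true (by rw [hT_apply, decide_eq_true ht])]; exact him9)
    · rw [if_neg ht]
      exact andFn_apply hre (by rw [iteFn_apply_false (by rw [hT_apply, decide_eq_false ht])]; exact him3)

/-- **(ii) The unit-cube promise problem is in `PromiseBQP`.** On the promise the post-processor writes
exactly the bit `[UnitCubeAtThree d]` (`key`; the pair `IsMirrorFundUnit d a b` is unique). [folklore] -/
theorem cube_mem_PromiseBQP :
    (⟨encodingNatBool.toLanguage {d : ℕ | IsNegFundamentalDiscr d ∧ d ≠ 3 ∧ UnitCubeAtThree d},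
      encodingNatBool.toLanguage {d : ℕ | IsNegFundamentalDiscr d ∧ d ≠ 3 ∧ ¬ UnitCubeAtThree d}⟩ :
        PromiseProblem) ∈ PromiseBQP := by
  classical
  obtain ⟨f, hf, hfspec⟩ := JacobsonWilliams2008_unitResidue_mem_FP_holds
  obtain ⟨pre, hpre, hpre_apply⟩ := exists_mirrorPre
  obtain ⟨post, hpost, hpost_apply⟩ := exists_cubePost hf hpre
  have key : ∀ d : ℕ, IsNegFundamentalDiscr d → d ≠ 3 → ∀ y : List Bool,
      (∀ (K : Type) [Field K] [NumberField K], Squarefree (mirrorRadicand d) → 2 ≤ mirrorRadicand d →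
        Module.finrank ℚ K = 2 → (∃ α : K, α ^ 2 = ((mirrorRadicand d : ℕ) : K)) →
        ∃ (m : ℕ) (w : List Bool),
          (m = ⌊NumberField.Units.regulator K⌋₊ ∨ m = ⌈NumberField.Units.regulator K⌉₊) ∧
            y = boolPair (encodeNat m) w) →
      post (boolPair (encodeNat d) y) = [decide (UnitCubeAtThree d)] := by
    intro d hfund h3 y hy
    obtain ⟨hsf, h2, a, b, hab, huniq, hlog⟩ := AvgFaceBeyondPrior.Mirror.stub_mirrorUnitData d hfund h3
    obtain ⟨K, _, _, hK, hα⟩ := exists_quadraticField_sqrt hsf h2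
    obtain ⟨m, w, hm, rfl⟩ := hy K hsf h2 hK hα
    have hfx := hfspec (mirrorRadicand d) m 9 a b hsf h2 (by norm_num) hab.1 hab.2.1 hab.2.2 (hlog K hK hα m hm)
    rw [← hpre_apply] at hfx
    obtain ⟨P₁, P₂, hP₁, hP₂, hcong, hval⟩ := hpost_apply (encodeNat d) m w (a % 9) (b % 9) hfx
    obtain ⟨hc₁, hc₂⟩ := hcong (mirrorRadicand d : ℤ) ((⟨(a : ℤ), (b : ℤ)⟩ : ℤ√(mirrorRadicand d : ℤ)))
      (by rw [ZMod.natCast_mod]; simp) (by rw [ZMod.natCast_mod]; simp)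
      (by rw [hpre_apply, bitsToNat_encodeNat]; simp)
    have e₁ := (ZMod.intCast_eq_intCast_iff' _ _ 9).1 ((Int.cast_natCast (R := ZMod 9) P₁).trans hc₁)
    have e₂ := (ZMod.intCast_eq_intCast_iff' _ _ 9).1 ((Int.cast_natCast (R := ZMod 9) P₂).trans hc₂)
    simp only [Nat.cast_ofNat] at e₁ e₂
    have hiff : UnitCubeAtThree d ↔ (unitPow8 d a b).re % 9 = 4 ∧ (3 ∣ d → (9 : ℤ) ∣ (unitPow8 d a b).im) ∧
        (¬ 3 ∣ d → (3 : ℤ) ∣ (unitPow8 d a b).im) :=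
      ⟨fun ⟨a', b', hab', hc'⟩ => by obtain ⟨rfl, rfl⟩ := huniq a' b' hab'; exact hc', fun hc => ⟨a, b, hab, hc⟩⟩
    rw [hval, bitsToNat_encodeNat]
    congr 1
    rw [Bool.eq_iff_iff, decide_eq_true_iff, hiff, Int.dvd_iff_emod_eq_zero, Int.dvd_iff_emod_eq_zero,
      Nat.dvd_iff_mod_eq_zero]
    unfold unitPow8
    split_ifs with h3 <;> simp only [Bool.and_eq_true, decide_eq_true_eq] <;> constructor
    · exact fun ⟨h1, h2⟩ => ⟨by omega, fun _ => by omega, fun h' => absurd h3 h'⟩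
    · exact fun ⟨h1, h2, _⟩ => by have := h2 h3; exact ⟨by omega, by omega⟩
    · exact fun ⟨h1, h2⟩ => ⟨by omega, fun h' => absurd h' h3, fun _ => by omega⟩
    · exact fun ⟨h1, _, h2⟩ => by have := h2 h3; exact ⟨by omega, by omega⟩
  refine Literature.Computability.QuantumComplexity.mem_PromiseBQP_of_isQSolvable _ pre post hpre hpost
    Hallgren2007_regulator_qsolvable_delim_holds ?_ ?_ <;> rintro x ⟨d, ⟨hfund, h3, hc⟩, rfl⟩ y hy <;>
    simp only [Set.mem_setOf_eq, FactPostFP.encodingNatBool_encode, hpre_apply, decode_encodeNat] at hy <;>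
    rw [FactPostFP.encodingNatBool_encode, key d hfund h3 y hy]
  · rw [decide_eq_true hc]
  · rw [decide_eq_false hc]

end Helpers

/-! ## The registered stub (signature verbatim) -/

/-- **S3 `stub_frontEnd`** (M–L plumbing over PROVED facts; reshape r4: T1 is a PROMISE problem).
(i) `FUND ∈ BQP` (`fund_mem_BQP`): factor the core `d` resp. `d/4` by Shor (`isQSolvable_factoring_holds`) inside ONE
classical wrap (`isQSolvable_classicalWrap_holds`; `FP` post-processor: canonicity of the word, the congruences of
`IsNegFundamentalDiscr`, no repeated prime), then `mem_BQP_of_isQSolvable_bit` (the bit is correct on EVERY input).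
(ii) `(cubeYes, cubeNo) ∈ PromiseBQP` (`cube_mem_PromiseBQP`): ONE `PromiseWrap.mem_PromiseBQP_of_isQSolvable` around the
GRH-free regulator relation `Hallgren2007_regulator_qsolvable_delim_holds`, pre-processor `bin d ↦ bin (mirrorRadicand d)`;
on the promise `|log ε − m| < 1` for the mirror unit `ε = (a + b√d₀)/2` (`stub_mirrorUnitData`), so the `FP` function of
`JacobsonWilliams2008_unitResidue_mem_FP_holds` returns `(a mod 9, b mod 9)` and the post-processor evaluates the cube
condition from `(a, b, d₀) mod 9` (three squarings in `ℤ[√d₀]` modulo `9`; the pair `IsMirrorFundUnit d a b` is unique). -/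
theorem stub_frontEnd :
    encodingNatBool.toLanguage {d : ℕ | IsNegFundamentalDiscr d} ∈ BQP ∧
      (⟨encodingNatBool.toLanguage {d : ℕ | IsNegFundamentalDiscr d ∧ d ≠ 3 ∧ UnitCubeAtThree d},
        encodingNatBool.toLanguage {d : ℕ | IsNegFundamentalDiscr d ∧ d ≠ 3 ∧ ¬ UnitCubeAtThree d}⟩ :
          PromiseProblem) ∈ PromiseBQP := by
  exact ⟨fund_mem_BQP, cube_mem_PromiseBQP⟩

end Summit.QuantumAdvantage.QuantumAdvantage.Theorems.ArithStatLadder.IqThreeMemBQP
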